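import Summits.NavierStokesRegularity.FunctionalMining.StrainMomentBalance
import Summits.NavierStokesRegularity.FunctionalMining.StrainMomentSaturatingLaw
import Summits.NavierStokesRegularity.FunctionalMining.VorticityMomentHolder
import Summits.NavierStokesRegularity.FunctionalMining.StrainEigen
import HarnessLib

/-!
# FunctionalMining — NOGO N8 in the kernel: the `‖ω‖_∞` rate rows of `∫|S|^q` for every real `q > 2`

Search for candidate a priori estimates; no regularity claim. Cell `pub-nsfunc`, prove seat
(gen 13). The no-go seat's Calderón–Zygmund closure N8 (= K0-FLAGS A5; typed by the dictionary
seat as `StrainMomentCZClosure`, `@[conjecture]` "until its `L^q` inputs are tree facts") for the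
strain moments at every REAL exponent `q > 2`, as a kernel theorem on `T³ = UnitAddTorus (Fin 3)`:

**`StrainMoment.rateSupBound_rpow`** — for every real `q > 2` there is `C ≥ 0` with
`StrainMomentRateSupBound q C`: along every classical solution of unforced Navier–Stokes/Euler
(`ν ≥ 0`) on `T³ × [a, b]`, at every time `t` with `|ω(t, ·)| ≤ M` pointwise, every one-sided
derivative value `R` of `s ↦ ∫|S(u s)|^q` satisfies `R ≤ C · M · ∫|S(u t)|^q`
(K0 rows `ES.absS.q|T_C|C1`, majorant form of Doering–Gibbon's `dℰ/dt ≤ 2‖ω‖_∞ℰ`).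

Assembly (NOGO.md N8, with the sup on ONE vorticity factor), all inputs tree lemmas:

* slice form of the exact `∫|S|^q` balance (`GradientTensor.derivWithin_Bq_le`):
  `Ḃ_q ≤ −qνI − qX_P − qX_N` with `I ≥ 0`;
* `|X_N| ≤ ∫φ^{q−1}g`, `|X_P| ≤ ∫φ^{q−1}h` (`φ = |S|`, `g = |∇u|²`, `h = ∑ᵢⱼ|∂ᵢ∂ⱼp|`;
  `StrainMoment.abs_nonlinear_production_le`, `abs_pressure_production_le`) and Hölder
  `∫φ^{q−1}G ≤ (∫φ^q)^{(q−1)/q}(∫G^q)^{1/q}`;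
* Calderón–Zygmund twice and the sup once:
  `∫g^q ≤ K₁∫|ω|^{2q} ≤ K₁M^q∫|ω|^q ≤ K₁M^q 2^{q/2}∫g^{q/2} ≤ K₁ 2^{q/2} K₂ M^q ∫φ^q`
  (`VorticityMoment.exists_cz_rpow` at `q`, `|ω|² ≤ 2|∇u|²`, `StrainMoment.exists_cz_rpow` at `q/2`);
* the pressure Hessian in `L^q` (not `L^∞`): `∫h^q ≤ 9^q C_P ∫g^q` (`exists_hess_rpow`,
  `integral_sum_abs_rpow_le`).

Hence `R ≤ q (K₃^{1/q} + (9^q C_P K₃)^{1/q}) M ∫|S|^q`, `K₃ = K₁ 2^{q/2} K₂` — existential (the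
`L^p` Calderón–Zygmund constants are not explicit), exactly as N8 says; the endpoints `q = ∞`
(CZ fails) and `1 < q ≤ 2` (singular weight; `q = 2` is the tree's `strainMomentRateSupBound_two`)
are not covered here. Corollaries: the `q > 2` half of `StrainMomentCZClosure`
(`strainMomentCZClosure_of_two_lt`), the matrix rows `q = 3, 4`, the generic-shape reading
`FunctionalRateSupBound (torusStrainMoment q) C`, and — by the dictionary's PROVED domination
`strainMomentLogBudget_of_rateSupBound` (A5) — the log rows `ES.absS.q|T_CL|C1|j` for every `j` and
every `c ≥ 0`, literally the candidate rows `ES.absS.q=3|T_CL|C1|j=1`, `ES.absS.q=4|T_CL|C1|j=1`.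
Closing any of these under `∫‖ω‖_∞ dt < ∞` only re-derives Beale–Kato–Majda (K0 `closing`): they are
CONTROL rows; the content here is that N8 is now kernel-checked for `q > 2`.
-/

noncomputable section

open MeasureTheory Finset Set Filter Topology
open scoped InnerProductSpace RealInnerProductSpace ContDiff

namespace Summit.NavierStokesRegularity.FunctionalMining

open Literature.Analysis.FunctionSpaces Literature.Analysis.FunctionSpaces.Torus
  Literature.Analysis.FluidPDE

namespace StrainMoment

open StrainL4 VorticityL4

/-! ## 1. Two pointwise vorticity facts on `T³` -/

/-- `‖curl v x‖^q ≤ 2^{q/2} (∑ₖ‖∂ₖv x‖²)^{q/2}` for `q ≥ 0` (`|ω|² ≤ 2|∇v|²_F`). [folklore] -/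
theorem norm_curl_rpow_le (v : UnitAddTorus (Fin 3) → EuclideanSpace ℝ (Fin 3))
    (x : UnitAddTorus (Fin 3)) {q : ℝ} (hq : 0 ≤ q) :
    ‖BDSV.curl v x‖ ^ q ≤ (2 : ℝ) ^ (q / 2) * (∑ k, ‖partialDeriv k v x‖ ^ 2) ^ (q / 2) := by
  have hg0 : 0 ≤ ∑ k, ‖partialDeriv k v x‖ ^ 2 := Finset.sum_nonneg fun k _ => sq_nonneg _
  have h2 : ‖BDSV.curl v x‖ ^ 2 ≤ 2 * ∑ k, ‖partialDeriv k v x‖ ^ 2 := by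
    rw [norm_curl_sq]
    have h := half_torusVorticitySqAt_le_sum_norm_sq v x
    linarith
  have e1 : ‖BDSV.curl v x‖ ^ q = (‖BDSV.curl v x‖ ^ 2) ^ (q / 2) := by
    rw [← Real.rpow_natCast, ← Real.rpow_mul (norm_nonneg _)]
    congr 1
    push_cast
    ring
  rw [e1, ← Real.mul_rpow (by norm_num) hg0]
  exact Real.rpow_le_rpow (sq_nonneg _) h2 (by linarith)

/-- `‖curl v x‖^{2q} ≤ M^q ‖curl v x‖^q` when `|ω(x)|² ≤ M²`, `M ≥ 0`, `q ≥ 0`. [folklore] -/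
theorem norm_curl_rpow_two_mul_le (v : UnitAddTorus (Fin 3) → EuclideanSpace ℝ (Fin 3))
    (x : UnitAddTorus (Fin 3)) {M q : ℝ} (hM : 0 ≤ M) (hq : 0 ≤ q)
    (hω : torusVorticitySqAt v x ≤ M ^ 2) :
    ‖BDSV.curl v x‖ ^ (2 * q) ≤ M ^ q * ‖BDSV.curl v x‖ ^ q := by
  have hn : 0 ≤ ‖BDSV.curl v x‖ := norm_nonneg _
  have hle : ‖BDSV.curl v x‖ ≤ M := by
    rw [← norm_curl_sq] at hω
    exact (pow_le_pow_iff_left₀ hn hM two_ne_zero).1 hω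
  rw [show 2 * q = q + q by ring, Real.rpow_add_of_nonneg hn hq hq]
  exact mul_le_mul_of_nonneg_right (Real.rpow_le_rpow hn hle hq) (Real.rpow_nonneg hn _)

/-! ## 2. `∫|∇u|^{2q} ≤ K₃ M^q ∫|S|^q` — Calderón–Zygmund twice, the sup once -/

/-- **The gradient `2q`-moment against one sup of the vorticity.** For real `q > 2` there is
`K₃ ≥ 0` such that for every smooth divergence-free `v` on `T³` and every `M ≥ 0` with
`|ω|² ≤ M²` pointwise, `∫(∑ₖ‖∂ₖv‖²)^q ≤ K₃ M^q ∫‖strainFlat v‖^q`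
(`K₃ = K₁ 2^{q/2} K₂`: vorticity Calderón–Zygmund at `2q`, `|ω|^{2q} ≤ M^q|ω|^q`,
`|ω|² ≤ 2|∇v|²`, strain Calderón–Zygmund at `q`). [ours; NOGO N8] -/
theorem exists_gradMoment_le_sup_mul {q : ℝ} (hq : 2 < q) :
    ∃ K₃ : ℝ, 0 ≤ K₃ ∧ ∀ v : UnitAddTorus (Fin 3) → EuclideanSpace ℝ (Fin 3), IsSmooth v →
      IsDivFree v → ∀ M : ℝ, 0 ≤ M → (∀ x, torusVorticitySqAt v x ≤ M ^ 2) →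
        ∫ x, (∑ k, ‖partialDeriv k v x‖ ^ 2) ^ q ≤
          K₃ * M ^ q * ∫ x, ‖strainFlat v x‖ ^ q := by
  obtain ⟨K₁, hK₁0, hK₁⟩ := VorticityMoment.exists_cz_rpow (q := q) (by linarith)
  obtain ⟨K₂, hK₂0, hK₂⟩ := exists_cz_rpow (q := q / 2) (by linarith)
  refine ⟨K₁ * (2 : ℝ) ^ (q / 2) * K₂, by positivity, fun v hv hdiv M hM hω => ?_⟩
  have hq0 : 0 ≤ q := by linarith
  have hg0 : ∀ x, 0 ≤ ∑ k, ‖partialDeriv k v x‖ ^ 2 := fun x =>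
    Finset.sum_nonneg fun k _ => sq_nonneg _
  -- continuity of the integrands
  have hcq : Continuous fun x => ‖BDSV.curl v x‖ ^ q :=
    VorticityMoment.continuous_norm_curl_rpow hv hq0
  have hcg : Continuous fun x => (∑ k, ‖partialDeriv k v x‖ ^ 2) ^ (q / 2) :=
    (continuous_gradSq hv).rpow_const fun x => Or.inr (by linarith)
  -- (a) `∫ g^q ≤ K₁ ∫ |ω|^{2q}`
  have ha := hK₁ v hv hdiv
  -- (b) `∫ |ω|^{2q} ≤ M^q ∫ |ω|^q`
  have hb : ∫ x, ‖BDSV.curl v x‖ ^ (2 * q) ≤ M ^ q * ∫ x, ‖BDSV.curl v x‖ ^ q := by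
    rw [← integral_const_mul]
    exact integral_mono_of_nonneg (ae_of_all _ fun x => Real.rpow_nonneg (norm_nonneg _) _)
      (hcq.const_mul _ |>.integrable_unitAddTorus)
      (ae_of_all _ fun x => norm_curl_rpow_two_mul_le v x hM hq0 (hω x))
  -- (c) `∫ |ω|^q ≤ 2^{q/2} ∫ g^{q/2}`
  have hc : ∫ x, ‖BDSV.curl v x‖ ^ q ≤
      (2 : ℝ) ^ (q / 2) * ∫ x, (∑ k, ‖partialDeriv k v x‖ ^ 2) ^ (q / 2) := by
    rw [← integral_const_mul]
    exact integral_mono_of_nonneg (ae_of_all _ fun x => Real.rpow_nonneg (norm_nonneg _) _)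
      (hcg.const_mul _ |>.integrable_unitAddTorus)
      (ae_of_all _ fun x => norm_curl_rpow_le v x hq0)
  -- (d) `∫ g^{q/2} ≤ K₂ ∫ φ^q`
  have hd : ∫ x, (∑ k, ‖partialDeriv k v x‖ ^ 2) ^ (q / 2) ≤ K₂ * ∫ x, ‖strainFlat v x‖ ^ q := by
    have h := hK₂ v hv hdiv
    rw [show 2 * (q / 2) = q by ring] at h
    exact h
  have hMq : 0 ≤ M ^ q := Real.rpow_nonneg hM _
  have h2q : 0 ≤ (2 : ℝ) ^ (q / 2) := Real.rpow_nonneg (by norm_num) _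
  calc ∫ x, (∑ k, ‖partialDeriv k v x‖ ^ 2) ^ q
      ≤ K₁ * ∫ x, ‖BDSV.curl v x‖ ^ (2 * q) := ha
    _ ≤ K₁ * (M ^ q * ∫ x, ‖BDSV.curl v x‖ ^ q) := mul_le_mul_of_nonneg_left hb hK₁0
    _ ≤ K₁ * (M ^ q * ((2 : ℝ) ^ (q / 2) * ∫ x, (∑ k, ‖partialDeriv k v x‖ ^ 2) ^ (q / 2))) :=
        mul_le_mul_of_nonneg_left (mul_le_mul_of_nonneg_left hc hMq) hK₁0
    _ ≤ K₁ * (M ^ q * ((2 : ℝ) ^ (q / 2) * (K₂ * ∫ x, ‖strainFlat v x‖ ^ q))) :=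
        mul_le_mul_of_nonneg_left (mul_le_mul_of_nonneg_left
          (mul_le_mul_of_nonneg_left hd h2q) hMq) hK₁0
    _ = K₁ * (2 : ℝ) ^ (q / 2) * K₂ * M ^ q * ∫ x, ‖strainFlat v x‖ ^ q := by ring

/-! ## 3. Real-power bookkeeping: `F^{(q−1)/q} (A M^q F)^{1/q} = A^{1/q} M F` -/

/-- For `F, A, M ≥ 0` and `q > 0`: `F^{(q−1)/q} · (A · M^q · F)^{1/q} = A^{1/q} · M · F`. [folklore] -/
theorem rpow_bookkeeping {F A M q : ℝ} (hF : 0 ≤ F) (hA : 0 ≤ A) (hM : 0 ≤ M) (hq : 0 < q) :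
    F ^ ((q - 1) / q) * (A * M ^ q * F) ^ (1 / q) = A ^ (1 / q) * M * F := by
  have hq' : q ≠ 0 := hq.ne'
  have hMq : 0 ≤ M ^ q := Real.rpow_nonneg hM _
  rw [Real.mul_rpow (mul_nonneg hA hMq) hF, Real.mul_rpow hA hMq, ← Real.rpow_mul hM,
    show q * (1 / q) = 1 by field_simp, Real.rpow_one]
  have hFF : F ^ ((q - 1) / q) * F ^ (1 / q) = F := by
    have h1 : (q - 1) / q + 1 / q = 1 := by field_simp; ring
    rw [← Real.rpow_add' hF (by rw [h1]; norm_num), h1, Real.rpow_one]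
  calc F ^ ((q - 1) / q) * (A ^ (1 / q) * M * F ^ (1 / q))
      = A ^ (1 / q) * M * (F ^ ((q - 1) / q) * F ^ (1 / q)) := by ring
    _ = A ^ (1 / q) * M * F := by rw [hFF]

/-- Hölder + a `q`-th-power bound: if `∫φ^{q−1}G ≤ F^{(q−1)/q} (∫G^q)^{1/q}` and `∫G^q ≤ A M^q F`
(`F = ∫φ^q`), then `∫φ^{q−1}G ≤ A^{1/q} M F`. [folklore] -/
theorem holder_sup_chain {X F Gq A M q : ℝ} (hF : 0 ≤ F) (hGq : 0 ≤ Gq) (hA : 0 ≤ A) (hM : 0 ≤ M)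
    (hq : 0 < q) (hX : X ≤ F ^ ((q - 1) / q) * Gq ^ (1 / q)) (hG : Gq ≤ A * M ^ q * F) :
    X ≤ A ^ (1 / q) * M * F := by
  have h1 : Gq ^ (1 / q) ≤ (A * M ^ q * F) ^ (1 / q) :=
    Real.rpow_le_rpow hGq hG (by positivity)
  calc X ≤ F ^ ((q - 1) / q) * Gq ^ (1 / q) := hX
    _ ≤ F ^ ((q - 1) / q) * (A * M ^ q * F) ^ (1 / q) :=
        mul_le_mul_of_nonneg_left h1 (Real.rpow_nonneg hF _)
    _ = A ^ (1 / q) * M * F := rpow_bookkeeping hF hA hM hq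

/-! ## 4. N8 for real `q > 2` -/

/-- **NOGO N8 (K0-FLAGS A5) in the kernel for every real `q > 2`: the rows `ES.absS.q|T_C|C1` HOLD
with some constant.** There is `C ≥ 0` such that `StrainMomentRateSupBound q C` holds on
`T³ = UnitAddTorus (Fin 3)`: along every classical solution of unforced Navier–Stokes/Euler
(`ν ≥ 0`) on `[a, b]`, at every time `t` and for every pointwise vorticity majorant `M ≥ 0`
(`|ω(t,x)|² ≤ M²`), every one-sided derivative value `R` of `s ↦ ∫|S(u s)|^q` within `[a, b]` at
`t` satisfies `R ≤ C · M · ∫|S(u t)|^q`. `C = q (K₃^{1/q} + (9^q C_P K₃)^{1/q})` with `K₃` from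
`exists_gradMoment_le_sup_mul` and the pressure-Hessian Calderón–Zygmund constant `C_P` at `q`
(existential; CZ constants are not explicit). A CONTROL row: closing it needs `∫‖ω‖_∞ < ∞` (BKM).
[ours; NOGO.md N8 with tree inputs; cite: MajdaBertozziCUP2002 Prop. 10.6 for the CZ inputs, via the
imported files] -/
theorem rateSupBound_rpow {q : ℝ} (hq : 2 < q) :
    ∃ C : ℝ, 0 ≤ C ∧ StrainMomentRateSupBound (d := Fin 3) q C := by
  obtain ⟨K₃, hK₃0, hK₃⟩ := exists_gradMoment_le_sup_mul hq
  obtain ⟨CP, hCP0, hCP⟩ := exists_hess_rpow (d := Fin 3) (q := q) (by linarith)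
  have hq0 : 0 < q := by linarith
  have hq1 : (1 : ℝ) ≤ q := by linarith
  have h9 : 0 ≤ (9 : ℝ) ^ q * CP * K₃ := by positivity
  refine ⟨q * (K₃ ^ (1 / q) + ((9 : ℝ) ^ q * CP * K₃) ^ (1 / q)), by positivity, ?_⟩
  intro _ ν hν a b hab u p hsol t ht M hM hω R hR
  have hut : IsSmooth (u t) := hsol.smooth_velocity.isSmooth_slice ht
  have hdiv : IsDivFree (u t) := hsol.divFree t ht
  have hpt : IsSmooth (p t) := hsol.smooth_pressure.isSmooth_slice ht
  have hφc : Continuous (strainFlat (u t)) := continuous_strainFlat hut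
  have hg0 : ∀ x, 0 ≤ ∑ k, ‖partialDeriv k (u t) x‖ ^ 2 := fun x =>
    Finset.sum_nonneg fun k _ => sq_nonneg _
  have hh0 : ∀ x, 0 ≤ ∑ i, ∑ j, |partialDeriv i (partialDeriv j (p t)) x| := fun x =>
    Finset.sum_nonneg fun i _ => Finset.sum_nonneg fun j _ => abs_nonneg _
  -- the derivative value is the `derivWithin`, bounded by the slice form of the balance
  have hF : (fun s => torusStrainMoment q (u s)) =
      fun s => ∫ x, torusStrainSqAt (u s) x ^ (q / 2) := rfl
  obtain ⟨_, hle⟩ := GradientTensor.derivWithin_Bq_le hab hν hsol hq ht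
  have hUD : UniqueDiffWithinAt ℝ (Icc a b) t := uniqueDiffOn_Icc hab t ht
  have hRD : R = derivWithin (fun s => ∫ x, torusStrainSqAt (u s) x ^ (q / 2)) (Icc a b) t := by
    rw [← hF]; exact (hR.derivWithin hUD).symm
  rw [← hRD] at hle
  -- opaque names
  obtain ⟨XN, hXN⟩ : ∃ X : ℝ, X = ∫ x, torusStrainSqAt (u t) x ^ (q / 2 - 1) * ∑ i, ∑ j,
      (partialDeriv j (u t) x i + partialDeriv i (u t) x j) / 2 *
        ∑ k, partialDeriv i (u t) x k * partialDeriv k (u t) x j := ⟨_, rfl⟩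
  obtain ⟨XP, hXP⟩ : ∃ X : ℝ, X = ∫ x, torusStrainSqAt (u t) x ^ (q / 2 - 1) * ∑ i, ∑ j,
      (partialDeriv j (u t) x i + partialDeriv i (u t) x j) / 2 *
        partialDeriv i (partialDeriv j (p t)) x := ⟨_, rfl⟩
  obtain ⟨I, hI⟩ : ∃ I : ℝ, I = ∫ x, torusStrainSqAt (u t) x ^ (q / 2 - 1) * ∑ k, ∑ i, ∑ j,
      ((partialDeriv k (partialDeriv j (u t)) x i +
        partialDeriv k (partialDeriv i (u t)) x j) / 2) ^ 2 := ⟨_, rfl⟩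
  obtain ⟨F, hFq⟩ : ∃ F : ℝ, F = ∫ x, ‖strainFlat (u t) x‖ ^ q := ⟨_, rfl⟩
  obtain ⟨G, hG⟩ : ∃ G : ℝ, G = ∫ x, (∑ k, ‖partialDeriv k (u t) x‖ ^ 2) ^ q := ⟨_, rfl⟩
  obtain ⟨Hq, hHq⟩ : ∃ H : ℝ, H = ∫ x, (∑ i, ∑ j, |partialDeriv i (partialDeriv j (p t)) x|) ^ q :=
    ⟨_, rfl⟩
  rw [← hXN, ← hXP, ← hI] at hle
  have hI0 : 0 ≤ I := by
    rw [hI]; exact integral_nonneg fun x => mul_nonneg (Real.rpow_nonneg (torusStrainSqAt_nonneg _ _) _)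
      (Finset.sum_nonneg fun k _ => Finset.sum_nonneg fun i _ =>
        Finset.sum_nonneg fun j _ => sq_nonneg _)
  have hF0 : 0 ≤ F := by rw [hFq]; exact integral_nonneg fun x => Real.rpow_nonneg (norm_nonneg _) _
  have hG0 : 0 ≤ G := by rw [hG]; exact integral_nonneg fun x => Real.rpow_nonneg (hg0 x) _
  have hHq0 : 0 ≤ Hq := by rw [hHq]; exact integral_nonneg fun x => Real.rpow_nonneg (hh0 x) _
  have hFm : torusStrainMoment q (u t) = F := by rw [torusStrainMoment_eq_integral_norm, hFq]
  -- (i) `G ≤ K₃ M^q F`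
  have hGle : G ≤ K₃ * M ^ q * F := by rw [hG, hFq]; exact hK₃ (u t) hut hdiv M hM hω
  -- (ii) `|X_N| ≤ K₃^{1/q} M F`
  have hN : |XN| ≤ K₃ ^ (1 / q) * M * F := by
    have h := abs_nonlinear_production_le hut hq.le
    have h' := integral_rpow_mul_le_holder hφc.norm (continuous_gradSq hut) (fun x => norm_nonneg _)
      hg0 (by linarith : 1 < q)
    rw [← hXN] at h
    rw [← hFq, ← hG] at h'
    exact holder_sup_chain hF0 hG0 hK₃0 hM hq0 (h.trans h') hGle
  -- (iii) `∫h^q ≤ 9^q C_P G ≤ 9^q C_P K₃ M^q F` and `|X_P| ≤ (9^q C_P K₃)^{1/q} M F`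
  have hHle : Hq ≤ (9 : ℝ) ^ q * CP * K₃ * M ^ q * F := by
    have hH := integral_sum_abs_rpow_le (d := Fin 3)
      (H := fun i j x => partialDeriv i (partialDeriv j (p t)) x)
      (fun i j => ((hpt.partialDeriv j).partialDeriv i).continuous) hq1
    simp only [Fintype.card_fin, Nat.cast_ofNat] at hH
    have hsum : ∑ i : Fin 3, ∑ j : Fin 3, ∫ x, |partialDeriv i (partialDeriv j (p t)) x| ^ q ≤
        ∑ i : Fin 3, ∑ j : Fin 3, CP * G := by
      refine Finset.sum_le_sum fun i _ => Finset.sum_le_sum fun j _ => ?_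
      rw [hG]; exact hCP hab hsol t ht i j
    have hsum' : ∑ i : Fin 3, ∑ j : Fin 3, CP * G = 9 * (CP * G) := by
      simp only [Finset.sum_const, Finset.card_univ, Fintype.card_fin]
      ring
    have h9' : ((3 : ℝ) ^ 2) ^ (q - 1) * 9 = (9 : ℝ) ^ q := by
      rw [show (3 : ℝ) ^ 2 = 9 by norm_num, Real.rpow_sub (by norm_num : (0 : ℝ) < 9),
        Real.rpow_one]
      field_simp
    have h9q : 0 ≤ ((3 : ℝ) ^ 2) ^ (q - 1) := Real.rpow_nonneg (by norm_num) _
    have hMq : 0 ≤ M ^ q := Real.rpow_nonneg hM _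
    calc Hq ≤ ((3 : ℝ) ^ 2) ^ (q - 1) *
          ∑ i : Fin 3, ∑ j : Fin 3, ∫ x, |partialDeriv i (partialDeriv j (p t)) x| ^ q := by
          rw [hHq]; exact hH
      _ ≤ ((3 : ℝ) ^ 2) ^ (q - 1) * (9 * (CP * G)) := by
          rw [← hsum']; exact mul_le_mul_of_nonneg_left hsum h9q
      _ ≤ ((3 : ℝ) ^ 2) ^ (q - 1) * (9 * (CP * (K₃ * M ^ q * F))) := by gcongr
      _ = (((3 : ℝ) ^ 2) ^ (q - 1) * 9) * CP * K₃ * M ^ q * F := by ring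
      _ = (9 : ℝ) ^ q * CP * K₃ * M ^ q * F := by rw [h9']
  have hP : |XP| ≤ ((9 : ℝ) ^ q * CP * K₃) ^ (1 / q) * M * F := by
    have h := abs_pressure_production_le hut hpt hq.le
    have h' := integral_rpow_mul_le_holder hφc.norm (continuous_hessAbs hpt) (fun x => norm_nonneg _)
      hh0 (by linarith : 1 < q)
    rw [← hXP] at h
    rw [← hFq, ← hHq] at h'
    have hHle' : Hq ≤ (9 : ℝ) ^ q * CP * K₃ * M ^ q * F := hHle
    exact holder_sup_chain hF0 hHq0 h9 hM hq0 (h.trans h') (by linarith [hHle'])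
  -- (iv) assemble
  rw [hFm]
  have hXN' : -XN ≤ |XN| := neg_le_abs XN
  have hXP' : -XP ≤ |XP| := neg_le_abs XP
  have hνI : 0 ≤ q * ν * I := by positivity
  have h1 : -(q * ν * I) - q * XP - q * XN ≤
      q * (K₃ ^ (1 / q) + ((9 : ℝ) ^ q * CP * K₃) ^ (1 / q)) * M * F := by
    have h2 : -XP + -XN ≤ ((9 : ℝ) ^ q * CP * K₃) ^ (1 / q) * M * F + K₃ ^ (1 / q) * M * F :=
      add_le_add (hXP'.trans hP) (hXN'.trans hN)
    have h3 := mul_le_mul_of_nonneg_left h2 hq0.le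
    nlinarith
  exact hle.trans h1

/-- **The `q > 2` half of `StrainMomentCZClosure` (NOGO N8 / K0-FLAGS A5) is a theorem** on `T³`:
for every real `q > 2` there is `C` with `StrainMomentRateSupBound q C`. (The dictionary's
`StrainMomentCZClosure` asks for all `1 < q`; `q = 2` is `strainMomentRateSupBound_two` with `C = 2`;
`1 < q < 2` — singular weight — is not covered.) [ours] -/
theorem strainMomentCZClosure_of_two_lt :
    ∀ q : ℝ, 2 < q → ∃ C : ℝ, StrainMomentRateSupBound (d := Fin 3) q C := fun _ hq =>
  let ⟨C, _, hC⟩ := rateSupBound_rpow hq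
  ⟨C, hC⟩

/-- **Generic-shape reading:** `FunctionalRateSupBound (torusStrainMoment q) C` (the dictionary's
one rate shape for every `T_C|C1` row, `StrainEigen.lean`) holds for some `C ≥ 0`, every real
`q > 2`, on `T³` — the two spellings agree definitionally. [ours] -/
theorem functionalRateSupBound_rpow {q : ℝ} (hq : 2 < q) :
    ∃ C : ℝ, 0 ≤ C ∧ FunctionalRateSupBound (d := Fin 3) (torusStrainMoment q) C :=
  rateSupBound_rpow hq

/-! ## 5. The matrix rows `q = 3, 4` and the log rows -/

/-- **Row `ES.absS.q=3|T_C|C1` (kernel, control):** `∃ C ≥ 0, StrainMomentRateSupBound 3 C` on `T³` —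
`d/dt ∫|S|³ ≤ C ‖ω‖_∞ ∫|S|³` in majorant form. [ours] -/
theorem rateSupBound_three : ∃ C : ℝ, 0 ≤ C ∧ StrainMomentRateSupBound (d := Fin 3) 3 C :=
  rateSupBound_rpow (by norm_num)

/-- **Row `ES.absS.q=4|T_C|C1` (kernel, control):** `∃ C ≥ 0, StrainMomentRateSupBound 4 C` on `T³`.
[ours] -/
theorem rateSupBound_four : ∃ C : ℝ, 0 ≤ C ∧ StrainMomentRateSupBound (d := Fin 3) 4 C :=
  rateSupBound_rpow (by norm_num)

/-- **Rows `ES.absS.q|T_CL|C1|j` for every real `q > 2`, every `j` and every `c ≥ 0` (kernel):**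
there is `C ≥ 0` with `StrainMomentLogBudget q j C c` on `T³` —
`d/dt ∫|S|^q ≤ C ‖ω‖_∞ ∫|S|^q log^j(e + c∫|S|^q/ν^q)` in majorant form; by N8 above and the
dictionary's PROVED domination `strainMomentLogBudget_of_rateSupBound` (A5: the log factor is `≥ 1`).
[ours] -/
theorem logBudget_rpow {q : ℝ} (hq : 2 < q) (j : ℕ) {c : ℝ} (hc : 0 ≤ c) :
    ∃ C : ℝ, 0 ≤ C ∧ StrainMomentLogBudget (d := Fin 3) q j C c := by
  obtain ⟨C, hC0, hC⟩ := rateSupBound_rpow hq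
  exact ⟨C, hC0, strainMomentLogBudget_of_rateSupBound hC hC0 hc⟩

/-- **Candidate row `ES.absS.q=3|T_CL|C1|j=1` (K0-FLAGS A5; kernel):** for every `c ≥ 0` there is
`C ≥ 0` with `StrainMomentLogBudget 3 1 C c` on `T³`. [ours] -/
theorem logBudget_three_one {c : ℝ} (hc : 0 ≤ c) :
    ∃ C : ℝ, 0 ≤ C ∧ StrainMomentLogBudget (d := Fin 3) 3 1 C c :=
  logBudget_rpow (by norm_num) 1 hc

/-- **Candidate row `ES.absS.q=4|T_CL|C1|j=1` (K0-FLAGS A5; kernel):** for every `c ≥ 0` there is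
`C ≥ 0` with `StrainMomentLogBudget 4 1 C c` on `T³`. [ours] -/
theorem logBudget_four_one {c : ℝ} (hc : 0 ≤ c) :
    ∃ C : ℝ, 0 ≤ C ∧ StrainMomentLogBudget (d := Fin 3) 4 1 C c :=
  logBudget_rpow (by norm_num) 1 hc

/-- Measurement rows `ES.absS.q=3|T_CL|C1|j=2`, `ES.absS.q=4|T_CL|C1|j=2` (kernel): the same with
`j = 2`. [ours] -/
theorem logBudget_three_two_and_four_two {c : ℝ} (hc : 0 ≤ c) :
    (∃ C : ℝ, 0 ≤ C ∧ StrainMomentLogBudget (d := Fin 3) 3 2 C c) ∧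
      ∃ C : ℝ, 0 ≤ C ∧ StrainMomentLogBudget (d := Fin 3) 4 2 C c :=
  ⟨logBudget_rpow (by norm_num) 2 hc, logBudget_rpow (by norm_num) 2 hc⟩

end StrainMoment

end Summit.NavierStokesRegularity.FunctionalMining

end
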